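import Summits.QuantumAdvantage.QuantumAdvantage.Theorems.CubicForrelationNearExactIsExactFourteenDigits
import Summits.QuantumAdvantage.QuantumAdvantage.Theorems.NearExactIsExact.Negative.CoverFiveParityFourteen
import HarnessLib

/-!
# No constant odd residue of `W_g/32 (mod 8)` on 14 bits (NearExactIsExact, disprover's structure file, n = 14)

Negative-side STRUCTURE for the crux `CubicForrelation.NearExactIsExact` (item `near_exact_is_exact`,
stmt-QuantumAdvantage-14043) at `n = 14`, from the B2b disprover seat (gen 15). HONEST FRAMING: a THEOREM about
cubic Boolean functions on the finite slice `n = 14`, NOT summit progress.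

**Theorem (`no_constant_residue`).** No cubic `g : 𝔽₂¹⁴ → 𝔽₂` has `W_g(x)/32 ≡ c (mod 8)` for all `x` with `c` odd.
(For a cubic on 14 bits `W_g ∈ 32ℤ`, `fd_cube_sum`; even constant residues do occur, e.g. `c = 4` for bent `g`.)

Use. In the open window `(15/16, 31/32)` at `n = 14` the landed second-boundary analysis
(`CubicForrelationNearExactIsExactFourteenSecondStructureB`, `fo_second_structure_sharp`) leaves "case A" pairs:
both spectra with `u = W/32 ≡ ±3 (mod 8)` everywhere, `u ≡ 4 + χ (mod 8)` with `χ = ±(−1)^{d₁}` and `d₁` a quadratic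
of rank `≤ 2`. The present theorem kills the RANK-ZERO sub-case (`d₁` constant, i.e. `u ≡ 5` or `u ≡ 3 (mod 8)`
everywhere, `no_caseA_rank_zero`; in the tree's vocabulary `caseA_digitOne_nonconstant`: the digit `[⌊u/2⌋ odd]` of a
type-O case-A cubic takes both values): any case-A cubic on 14 bits has `rank d₁ = 2` exactly.

## The argument (saturated monomial configurations, one vertex at a time)

Write `(−1)^{g} = Π_s (1 − 2[s ⊆ x])` over the monomials `s` of `g` and expand the bias over a coordinate cube
`E_K` (`cube_bias_expand`): the set `S` of monomials contributes `(−2)^{|S|} 2^{|K| − |U_S|} [U_S ⊆ K]`,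
`U_S = ⋃_{s ∈ S} supp s`. For `3m − 1 ≤ |K| ≤ 3m` only the `m`-sets `S` with `U_S = K` survive modulo `2^{m+1}`
(`cube_bias_congr`), so with `N_m(K) := #{S : |S| = m, U_S = K}` and Poisson summation over `E_{Kᶜ}`:
* `K = univ` (`m = 5`): `u(0) ≡ N₅(univ) (mod 2)` — `c` odd forces `N₅` odd;
* `|K| = 12` (`m = 4`): `Σ_{E_{Kᶜ}} u ≡ 2 N₄(K) (mod 4)`, and `Σ ≡ 4c ≡ 0 (mod 4)` — every `N₄(K)` is even;
* `|K| = 11` (`m = 4`): `Σ_{E_{Kᶜ}} u ≡ 4 N₄(K) (mod 8)`, and `Σ ≡ 8c ≡ 0 (mod 8)` — every `N₄(K)` is even.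
The combinatorial half is `CoverFiveParityFourteen.even_cov_five`: for monomials of degree `≤ 3` on `14` variables,
"`N₄(K)` even for all `|K| ∈ {11, 12}`" forces `N₅(univ)` even (one vertex at a time: simply-covered vertices pair up
with `4`-sets covering `11` or `12` variables, and every covering `5`-set has exactly one defect) — contradiction.

Numerical sanity check (seat folder `code/disprove-g15/dig14.c`): the three congruences and the counting identities
hold on random cubics (0 failures in 1.5·10⁵ checks); `N₅(univ)` is odd iff `g` is of type O.

Sources: J. Ax (1964) / R. McEliece (1972) (Carlet 2021 §4.1); MacWilliams–Sloane Ch. 13–15. Axioms: the standard three.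
-/

set_option linter.dupNamespace false -- D-0017: single-problem summit ⇒ `QuantumAdvantage.QuantumAdvantage` by design

noncomputable section

namespace Summit.QuantumAdvantage.QuantumAdvantage.Theorems.NearExactIsExact.Negative.NoConstantResidueFourteen

open Finset
open Literature.Computability.QuantumComplexity
open Literature.Computability.QuantumComplexity.DerivativeWalsh (W)
open Summit.QuantumAdvantage.QuantumAdvantage.Theorems.CubicForrelation.NearExactIsExact
open Summit.QuantumAdvantage.QuantumAdvantage.Theorems.NearExactIsExact.Negative.CoverFiveParityFourteen

/-! ### The monomial expansion modulo the next power of two (14 variables) -/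

section Expansion

variable (p : MvPolynomial (Fin (7 + 7)) (ZMod 2))

/-- The expansion of the integer bias sum of a polynomial phase over a coordinate cube `E_K` (14 variables):
`Σ_{x ∈ E_K} Π_s (−1)^{[supp s ⊆ supp x]} = Σ_{S ⊆ Mon(p)} [U_S ⊆ K] · (−2)^{|S|} · 2^{|K| − |U_S|}`.
[folklore; McEliece 1972 / Carlet 2021 §4.1; the `Fin (6+6)` version is `TypeOTwelve.cube_bias_expand`] -/
theorem cube_bias_expand (K : Finset (Fin (7 + 7))) :
    ∑ x ∈ {x : Fin (7 + 7) → Bool | ∀ i, x i = true → i ∈ K},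
        ∏ s ∈ p.support, (if (∀ j ∈ s.support, x j = true) then (-1 : ℤ) else 1) =
      ∑ S ∈ p.support.powerset,
        (if (S.biUnion fun s => s.support) ⊆ K then
          (-2 : ℤ) ^ #S * 2 ^ (#K - #(S.biUnion fun s => s.support)) else 0) := by
  simp_rw [ax_prod_sign_eq]
  rw [sum_comm]
  refine sum_congr rfl fun S _ => ?_
  simp_rw [ax_prod_indicator]
  rw [← sum_filter, sum_const, filter_filter, nsmul_eq_mul]
  by_cases hU : (S.biUnion fun s => s.support) ⊆ K
  · rw [ax_card_cube_sup hU, if_pos hU]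
    push_cast
    ring
  · rw [ax_card_cube_sup_eq_zero hU, if_neg hU]
    simp

/-- **Saturated terms** for cubes of dimension `3m` or `3m − 1`. For `p` of total degree `≤ 3` and
`3m − 1 ≤ |K| ≤ 3m`, modulo `2^{m+1}` only the sets of `m` monomials whose supports cover `K` exactly survive:
`Σ_{x ∈ E_K} Π_s (−1)^{[supp s ⊆ supp x]} = (−2)^m · #{S ⊆ Mon(p) : |S| = m, U_S = K} + 2^{m+1} k`
(a term with `|S| = a`, `U_S ⊆ K` has exponent `a + |K| − |U_S|` with `|U_S| ≤ min(3a, |K|)`: for `a ≤ m − 1` this is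
`≥ |K| − 2a ≥ m + 1`, for `a ≥ m + 1` it is `≥ m + 1`, and for `a = m` it is `≥ m` with equality iff `U_S = K`).
Used with `(|K|, m) = (14, 5), (12, 4), (11, 4)`. [this work; folklore method] -/
theorem cube_bias_congr (hp : p.totalDegree ≤ 3) (K : Finset (Fin (7 + 7))) (m : ℕ)
    (hK : 3 * m ≤ #K + 1) (hK' : #K ≤ 3 * m) :
    ∃ k : ℤ, ∑ x ∈ {x : Fin (7 + 7) → Bool | ∀ i, x i = true → i ∈ K},
        ∏ s ∈ p.support, (if (∀ j ∈ s.support, x j = true) then (-1 : ℤ) else 1) =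
      (-2 : ℤ) ^ m * (#{S ∈ p.support.powerset | #S = m ∧ (S.biUnion fun s => s.support) = K} : ℕ) +
        2 ^ (m + 1) * k := by
  have h1 : ∀ S ∈ {S ∈ p.support.powerset | #S = m ∧ (S.biUnion fun s => s.support) = K},
      (if (S.biUnion fun s => s.support) ⊆ K then
        (-2 : ℤ) ^ #S * 2 ^ (#K - #(S.biUnion fun s => s.support)) else 0) = (-2 : ℤ) ^ m := by
    intro S hS
    obtain ⟨-, hSm, hSU⟩ := mem_filter.1 hS
    rw [hSU, if_pos (Subset.refl K), hSm, Nat.sub_self, pow_zero, mul_one]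
  have h2 : ∀ S ∈ {S ∈ p.support.powerset | ¬ (#S = m ∧ (S.biUnion fun s => s.support) = K)},
      (2 : ℤ) ^ (m + 1) ∣ (if (S.biUnion fun s => s.support) ⊆ K then
        (-2 : ℤ) ^ #S * 2 ^ (#K - #(S.biUnion fun s => s.support)) else 0) := by
    intro S hS
    obtain ⟨hSp, hnot⟩ := mem_filter.1 hS
    split_ifs with hU
    · have hUS : #(S.biUnion fun s => s.support) ≤ 3 * #S := ax_card_biUnion_le hp (mem_powerset.1 hSp)
      have hUK : #(S.biUnion fun s => s.support) ≤ #K := card_le_card hU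
      have hne : ¬ (#S = m ∧ #(S.biUnion fun s => s.support) = #K) := by
        rintro ⟨hSm, hc⟩
        exact hnot ⟨hSm, eq_of_subset_of_card_le hU hc.ge⟩
      have hexp : m + 1 ≤ #S + (#K - #(S.biUnion fun s => s.support)) := by omega
      rw [neg_pow, mul_assoc, ← pow_add]
      exact Dvd.dvd.mul_left (pow_dvd_pow 2 hexp) _
    · exact dvd_zero _
  obtain ⟨k, hk⟩ := dvd_sum h2
  refine ⟨k, ?_⟩
  rw [cube_bias_expand p K, ← sum_filter_add_sum_filter_not p.support.powerset
    (fun S => #S = m ∧ (S.biUnion fun s => s.support) = K), sum_congr rfl h1, sum_const, nsmul_eq_mul, hk]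
  ring

end Expansion

/-! ### No constant odd residue -/

section Main

variable (g : (Fin (7 + 7) → Bool) → Bool) (u : (Fin (7 + 7) → Bool) → ℤ)

/-- **No constant odd residue of `W_g/32 (mod 8)` on 14 bits.** For cubic `g : 𝔽₂¹⁴ → 𝔽₂` with `W_g = 32·u`
there is no odd `c` with `u(x) ≡ c (mod 8)` for all `x`. [this work] -/
theorem no_constant_residue (hg : IsDegLeFun 3 g) (hu : ∀ x, W (fun y => signOf (g y)) x = (2 : ℝ) ^ 5 * (u x : ℝ))
    (c : ℤ) (hc : Odd c) (h : ∀ x, u x % 8 = c % 8) : False := by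
  obtain ⟨p, hp, hrep⟩ := id hg
  obtain ⟨t, ht⟩ := hc
  -- the integer bias sums over coordinate cubes
  have hbias : ∀ K : Finset (Fin (7 + 7)),
      ∑ x ∈ {x : Fin (7 + 7) → Bool | ∀ i, x i = true → i ∈ K}, signOf (g x) =
        ((∑ x ∈ {x : Fin (7 + 7) → Bool | ∀ i, x i = true → i ∈ K},
          ∏ s ∈ p.support, (if (∀ j ∈ s.support, x j = true) then (-1 : ℤ) else 1) : ℤ) : ℝ) := by
    intro K
    rw [Int.cast_sum]
    exact sum_congr rfl fun x _ => by rw [hrep x, ax_signOf_polyPhase]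
  -- Poisson summation: `32 Σ_{E_I} u = 2^{|I|} Σ_{E_{Iᶜ}} (−1)^g`
  have hpois : ∀ I : Finset (Fin (7 + 7)),
      (2 : ℝ) ^ 5 * ∑ x ∈ {x : Fin (7 + 7) → Bool | ∀ i, x i = true → i ∈ I}, (u x : ℝ) =
        (2 : ℝ) ^ #I * ∑ y ∈ {x : Fin (7 + 7) → Bool | ∀ i, x i = true → i ∈ Iᶜ}, signOf (g y) := by
    intro I
    have hP := bb_poisson (fun y => signOf (g y)) I
    rw [sum_congr rfl fun x _ => hu x, ← mul_sum] at hP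
    exact hP
  -- the cube sums of `u` modulo `8`
  have hsum : ∀ I : Finset (Fin (7 + 7)), ∑ x ∈ {x : Fin (7 + 7) → Bool | ∀ i, x i = true → i ∈ I}, u x =
      8 * ∑ x ∈ {x : Fin (7 + 7) → Bool | ∀ i, x i = true → i ∈ I}, (u x / 8) + 2 ^ #I * (c % 8) := by
    intro I
    rw [sum_congr rfl fun x _ => (show u x = 8 * (u x / 8) + c % 8 by have := h x; omega), sum_add_distrib,
      ← mul_sum, sum_const, nsmul_eq_mul]
    congr 1
    rw [bb_card_cube I]
    push_cast
    ring
  -- parity of `N₄(K)` for `|K| ∈ {11, 12}`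
  have hN₄ : ∀ K : Finset (Fin (7 + 7)), #K = 11 ∨ #K = 12 →
      Even #{S ∈ p.support.powerset | #S = 4 ∧ (S.biUnion fun s => s.support) = K} := by
    intro K hK
    obtain ⟨k, hk⟩ := cube_bias_congr p hp K 4 (by omega) (by omega)
    have h1 := hpois Kᶜ
    rw [compl_compl, hbias K, hk, ← Int.cast_sum, hsum Kᶜ, card_compl, Fintype.card_fin] at h1
    have h1z : (2 : ℤ) ^ 5 * (8 * ∑ x ∈ {x : Fin (7 + 7) → Bool | ∀ i, x i = true → i ∈ Kᶜ}, (u x / 8) +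
        2 ^ (7 + 7 - #K) * (c % 8)) = 2 ^ (7 + 7 - #K) * ((-2) ^ 4 *
          (#{S ∈ p.support.powerset | #S = 4 ∧ (S.biUnion fun s => s.support) = K} : ℕ) + 2 ^ (4 + 1) * k) := by
      exact_mod_cast h1
    generalize ∑ x ∈ {x : Fin (7 + 7) → Bool | ∀ i, x i = true → i ∈ Kᶜ}, (u x / 8) = Q at h1z
    simp only [show (2 : ℤ) ^ 5 = 32 by norm_num, show (-2 : ℤ) ^ 4 = 16 by norm_num] at h1z
    rw [← Int.even_coe_nat]
    rcases hK with hK | hK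
    · rw [hK, show (2 : ℤ) ^ (7 + 7 - 11) = 8 by norm_num] at h1z
      exact ⟨Q + c % 8 - k, by omega⟩
    · rw [hK, show (2 : ℤ) ^ (7 + 7 - 12) = 4 by norm_num] at h1z
      exact ⟨2 * Q + c % 8 - k, by omega⟩
  -- parity of `N₅(univ)`: odd
  obtain ⟨k₅, hk₅⟩ := cube_bias_congr p hp univ 5 (by rw [card_univ, Fintype.card_fin])
    (by rw [card_univ, Fintype.card_fin]; norm_num)
  have hE0 : #({x : Fin (7 + 7) → Bool | ∀ i, x i = true → i ∈ (∅ : Finset (Fin (7 + 7)))} : Finset _) = 1 := by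
    rw [bb_card_cube, card_empty, pow_zero]
  obtain ⟨a, ha⟩ := card_eq_one.1 hE0
  have h0 := hpois ∅
  rw [ha, sum_singleton, card_empty, pow_zero, one_mul, compl_empty, hbias univ, hk₅] at h0
  have h0z : (2 : ℤ) ^ 5 * u a = (-2) ^ 5 *
      (#{S ∈ p.support.powerset | #S = 5 ∧ (S.biUnion fun s => s.support) = univ} : ℕ) + 2 ^ (5 + 1) * k₅ := by
    exact_mod_cast h0
  obtain ⟨r, hr⟩ := even_cov_five hp (fun K hK => hN₄ K (Or.inl hK)) (fun K hK => hN₄ K (Or.inr hK))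
  have hua := h a
  rw [hr] at h0z
  push_cast at h0z
  omega

/-- **No rank-zero case A on 14 bits.** No cubic `g : 𝔽₂¹⁴ → 𝔽₂` has `W_g/32 ≡ 5 (mod 8)` everywhere, and none has
`W_g/32 ≡ 3 (mod 8)` everywhere: in the case-A normal form `u ≡ 4 + χ (mod 8)`, `χ = ±(−1)^{d₁}`, the quadratic `d₁`
is never constant. [this work] -/
theorem no_caseA_rank_zero (hg : IsDegLeFun 3 g)
    (hu : ∀ x, W (fun y => signOf (g y)) x = (2 : ℝ) ^ 5 * (u x : ℝ)) :
    (¬ ∀ x, u x % 8 = 5) ∧ ¬ ∀ x, u x % 8 = 3 :=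
  ⟨fun h => no_constant_residue g u hg hu 5 (by decide) fun x => by rw [h x]; norm_num,
    fun h => no_constant_residue g u hg hu 3 (by decide) fun x => by rw [h x]; norm_num⟩

/-- In the vocabulary of `fo_second_structure_sharp`: for a type-O cubic `g` on 14 bits in case A
(`[⌊u/2⌋ odd] ≠ [⌊u/4⌋ odd]` everywhere) the first digit `[⌊u/2⌋ odd]` takes BOTH values (it is not constant).
NOT summit progress. [this work] -/
theorem caseA_digitOne_nonconstant (hg : IsDegLeFun 3 g)
    (hu : ∀ x, W (fun y => signOf (g y)) x = (2 : ℝ) ^ 5 * (u x : ℝ)) (hodd : ∀ x, Odd (u x))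
    (hA : ∀ x, ¬ (Odd (u x / 2) ↔ Odd (u x / 2 / 2))) :
    (∃ x, Odd (u x / 2)) ∧ ∃ x, ¬ Odd (u x / 2) := by
  by_contra hcon
  rw [not_and_or, not_exists, not_exists] at hcon
  rcases hcon with h | h
  · -- `⌊u/2⌋` even everywhere ⇒ `u ≡ 5 (mod 8)`
    refine no_constant_residue g u hg hu 5 (by decide) fun x => ?_
    have h1 := hodd x
    have h2 := h x
    have h4 : Odd (u x / 2 / 2) := by
      by_contra h4
      exact hA x ⟨fun h5 => (h2 h5).elim, fun h5 => (h4 h5).elim⟩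
    rw [Int.odd_iff] at h1 h4
    have h2' : ¬ (u x / 2 % 2 = 1) := by rwa [← Int.odd_iff]
    omega
  · -- `⌊u/2⌋` odd everywhere ⇒ `u ≡ 3 (mod 8)`
    refine no_constant_residue g u hg hu 3 (by decide) fun x => ?_
    have h1 := hodd x
    have h2 := not_not.1 (h x)
    have h4 : ¬ Odd (u x / 2 / 2) := fun h4 => hA x ⟨fun _ => h4, fun _ => h2⟩
    rw [Int.odd_iff] at h1 h2
    have h4' : ¬ (u x / 2 / 2 % 2 = 1) := by rwa [← Int.odd_iff]
    omega

end Main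



end Summit.QuantumAdvantage.QuantumAdvantage.Theorems.NearExactIsExact.Negative.NoConstantResidueFourteen
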